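import Summits.CriticalPhenomena.PercolationContinuityZ3.Theorems.PercNearOneGluingNoHeavyLowerTailSahiTwoDimFKG

/-!
# `NoHeavyLowerTail` (crux stmt-CriticalPhenomena-4575), Sahi programme P1: the conditional-quantile (Rosenblatt) coupling
# with rows indexed by a PARTIAL order — tools for the three-dimensional reduction

Support file (Sahi cell, seat `prim-sahi-p1`, generation 3; `--supports stmt-CriticalPhenomena-4575`); part 1 of 2 (the
theorems are in `…SahiThreeDimFKG`).

Generation 2 (`SahiTwoDim`) realised every FKG weight on a product of TWO finite chains as a monotone image of a PRODUCT
weight (row-quantile / Knothe–Rosenblatt coupling), whence Sahi positivity of every order from Lieb–Sahi's theorem for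
product weights.  For THREE chains `α × β × γ` the same device is applied twice: first to the `(α × β)`-marginal, then to
the conditional laws of the `γ`-coordinate given the pair `(a, b) ∈ α × β` — rows now indexed by the LATTICE `α × β`, not by
a chain.  This file supplies the row-quantile coupling for rows indexed by an arbitrary finite partial order, allowing rows
of mass zero (`exists_rowQuantile_coupling`: the quantile map of a zero row is the supremum of the quantile maps of the
positive rows below it, which keeps the coupling monotone), the common grid (`exists_grid`), the stochastic monotonicity
of the rows of a log-supermodular weight indexed by a lattice (`cdf_cross_of_mul_le_mul`), and two push-forward
computations.  No definitions.  New mathematics (the assembly), standard ingredients.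
-/

namespace Summit.CriticalPhenomena.PercolationContinuityZ3.Theorems.SahiThreeDim

open Finset Function Literature.Combinatorics.Sahi2008 SahiTwoDim
open scoped BigOperators

noncomputable section

/-! ## Stochastic monotonicity of the rows, lattice-indexed -/

section Cross

variable {T : Type*} [Lattice T] {b : ℕ}

/-- **Log-supermodularity makes the rows stochastically increasing** (rows indexed by a lattice `T`):
`S_{p'}(j)·r_p ≤ S_p(j)·r_{p'}` for `p ≤ p'`, where `r_p = Σ_j μ(p,j)` and `S_p(j) = Σ_{j' ≤ j} μ(p,j')` (sum of the `2×2`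
minors `μ(p',j₁)μ(p,j₂) ≤ μ(p,j₁)μ(p',j₂)`, `j₁ ≤ j < j₂`). [this work] -/
theorem cdf_cross_of_mul_le_mul (μ : T × Fin (b + 1) → ℝ) (hμ : ∀ p q, μ p * μ q ≤ μ (p ⊓ q) * μ (p ⊔ q))
    {i i' : T} (hii' : i ≤ i') (j : Fin (b + 1)) :
    (∑ j', if j' ≤ j then μ (i', j') else 0) * (∑ j, μ (i, j)) ≤
      (∑ j', if j' ≤ j then μ (i, j') else 0) * (∑ j, μ (i', j)) := by
  have hsplit : ∀ k : T, (∑ j, μ (k, j)) =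
      (∑ j', if j' ≤ j then μ (k, j') else 0) + ∑ j', if j < j' then μ (k, j') else 0 := by
    intro k
    rw [← sum_add_distrib]
    refine sum_congr rfl fun j' _ => ?_
    by_cases h : j' ≤ j
    · rw [if_pos h, if_neg (not_lt.2 h), add_zero]
    · rw [if_neg h, if_pos (not_le.1 h), zero_add]
  rw [hsplit i, hsplit i', mul_add, mul_add,
    mul_comm ((∑ j', if j' ≤ j then μ (i', j') else 0)) ((∑ j', if j' ≤ j then μ (i, j') else 0))]
  refine add_le_add le_rfl ?_
  rw [sum_mul, sum_mul]
  refine sum_le_sum fun j₁ _ => ?_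
  rw [mul_sum, mul_sum]
  refine sum_le_sum fun j₂ _ => ?_
  by_cases h1 : j₁ ≤ j
  · by_cases h2 : j < j₂
    · rw [if_pos h1, if_pos h1, if_pos h2, if_pos h2]
      have h12 : j₁ ≤ j₂ := h1.trans h2.le
      have key := hμ (i', j₁) (i, j₂)
      have hinf : ((i', j₁) : T × Fin (b + 1)) ⊓ (i, j₂) = (i, j₁) := by
        ext
        · exact inf_eq_right.2 hii'
        · exact inf_eq_left.2 h12
      have hsup : ((i', j₁) : T × Fin (b + 1)) ⊔ (i, j₂) = (i', j₂) := by
        ext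
        · exact sup_eq_left.2 hii'
        · exact sup_eq_right.2 h12
      rw [hinf, hsup] at key
      exact key
    · rw [if_neg h2, if_neg h2, mul_zero, mul_zero]
  · rw [if_neg h1, if_neg h1, zero_mul, zero_mul]

end Cross

/-! ## The row-quantile coupling, rows indexed by a partial order, zero rows allowed -/

section Coupling

variable {ι : Type*} [PartialOrder ι] [Fintype ι] {b K : ℕ}

omit [PartialOrder ι] [Fintype ι] in
/-- A row of mass zero of a nonnegative weight vanishes identically. [folklore] -/
theorem row_eq_zero_of_mass (μ : ι × Fin (b + 1) → ℝ) (hμ0 : ∀ p, 0 ≤ μ p) {i : ι}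
    (hi : ¬ 0 < ∑ j, μ (i, j)) (j : Fin (b + 1)) : μ (i, j) = 0 := by
  have h1 : μ (i, j) ≤ ∑ j, μ (i, j) := single_le_sum (f := fun j => μ (i, j)) (fun j _ => hμ0 _) (mem_univ j)
  have h2 := hμ0 (i, j)
  have h3 : 0 ≤ ∑ j, μ (i, j) := sum_nonneg fun j _ => hμ0 _
  push Not at hi
  linarith

/-- **The row-quantile coupling** (rows indexed by a finite partial order; rows of mass zero allowed).  Let `μ ≥ 0` on
`ι × Fin (b+1)`, with row masses `r_i` and row distribution functions `S_i`, have stochastically increasing POSITIVE rows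
(`S_{i'}(j) r_i ≤ S_i(j) r_{i'}` for `i ≤ i'` both of positive mass), and let `γ : Fin (K+1) → ℝ` be a strictly increasing
grid from `0` to `1` containing every normalised value `S_i(j)/r_i` of a positive row.  Then there is a MONOTONE map
`G : ι × Fin K → ι × Fin (b+1)` over `ι` pushing the weight `r_i (γ_{u+1} − γ_u)` forward to `μ`: on a positive row
`G(i,u) = (i, min{j : γ_{u+1} r_i ≤ S_i(j)})`, and on a zero row the column is the supremum of these over the positive
rows below (which keeps `G` monotone and is immaterial for the push-forward). [this work] -/
theorem exists_rowQuantile_coupling (μ : ι × Fin (b + 1) → ℝ) (hμ0 : ∀ p, 0 ≤ μ p)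
    (hcross : ∀ i i' j, i ≤ i' → 0 < (∑ j, μ (i, j)) → 0 < (∑ j, μ (i', j)) →
      (∑ j', if j' ≤ j then μ (i', j') else 0) * (∑ j, μ (i, j)) ≤
        (∑ j', if j' ≤ j then μ (i, j') else 0) * (∑ j, μ (i', j)))
    (γ : Fin (K + 1) → ℝ) (hγ : StrictMono γ) (hγ1 : γ (Fin.last K) = 1) (hγ0 : γ 0 = 0)
    (hC : ∀ i j, 0 < (∑ j, μ (i, j)) → ∃ v, γ v * (∑ j, μ (i, j)) = (∑ j', if j' ≤ j then μ (i, j') else 0)) :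
    ∃ G : ι × Fin K → ι × Fin (b + 1), Monotone G ∧
      pushWeight (fun p : ι × Fin K => (∑ j, μ (p.1, j)) * (γ p.2.succ - γ (Fin.castSucc p.2))) G = μ := by
  classical
  -- the column map of a (positive) row and its characterisation `q₀ i u ≤ j ↔ γ_{u+1} r_i ≤ S_i(j)`
  have hne : ∀ i (u : Fin K), (univ.filter fun j : Fin (b + 1) =>
      γ u.succ * (∑ j, μ (i, j)) ≤ (∑ j', if j' ≤ j then μ (i, j') else 0)).Nonempty := by
    intro i u
    refine ⟨Fin.last b, ?_⟩
    rw [mem_filter, rowCDF_last]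
    refine ⟨mem_univ _, ?_⟩
    have hle : γ u.succ ≤ 1 := by rw [← hγ1]; exact hγ.monotone (Fin.le_last _)
    have hr : 0 ≤ ∑ j, μ (i, j) := sum_nonneg fun j _ => hμ0 _
    nlinarith
  obtain ⟨q₀, hq₀⟩ : ∃ q₀ : ι → Fin K → Fin (b + 1), ∀ i u j,
      q₀ i u ≤ j ↔ γ u.succ * (∑ j, μ (i, j)) ≤ (∑ j', if j' ≤ j then μ (i, j') else 0) := by
    refine ⟨fun i u => (univ.filter fun j : Fin (b + 1) =>
      γ u.succ * (∑ j, μ (i, j)) ≤ (∑ j', if j' ≤ j then μ (i, j') else 0)).min' (hne i u),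
      fun i u j => ⟨fun h => ?_, fun h => ?_⟩⟩
    · have hmem := min'_mem _ (hne i u)
      rw [mem_filter] at hmem
      exact hmem.2.trans (rowCDF_mono μ hμ0 i h)
    · exact min'_le _ _ (by rw [mem_filter]; exact ⟨mem_univ _, h⟩)
  -- `q₀` is monotone in the column index, and in the row index among positive rows
  have hq₀u : ∀ i (u u' : Fin K), u ≤ u' → q₀ i u ≤ q₀ i u' := by
    intro i u u' huu'
    rw [hq₀]
    have h1 : γ u'.succ * (∑ j, μ (i, j)) ≤ (∑ j', if j' ≤ q₀ i u' then μ (i, j') else 0) := (hq₀ i u' _).1 le_rfl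
    have h2 : γ u.succ ≤ γ u'.succ := hγ.monotone (Fin.succ_le_succ_iff.2 huu')
    have hr : 0 ≤ ∑ j, μ (i, j) := sum_nonneg fun j _ => hμ0 _
    nlinarith [mul_le_mul_of_nonneg_right h2 hr]
  have hq₀i : ∀ i i' (u : Fin K), i ≤ i' → 0 < (∑ j, μ (i, j)) → 0 < (∑ j, μ (i', j)) → q₀ i u ≤ q₀ i' u := by
    intro i i' u hii' hri hri'
    rw [hq₀]
    have h1 : γ u.succ * (∑ j, μ (i', j)) ≤ (∑ j', if j' ≤ q₀ i' u then μ (i', j') else 0) := (hq₀ i' u _).1 le_rfl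
    have h3 := hcross i i' (q₀ i' u) hii' hri hri'
    nlinarith [mul_le_mul_of_nonneg_right h1 hri.le]
  -- the column map on all rows: supremum over the positive rows below
  obtain ⟨q, hq⟩ : ∃ q : ι → Fin K → Fin (b + 1), ∀ i u,
      q i u = (univ.filter fun i' : ι => i' ≤ i ∧ 0 < ∑ j, μ (i', j)).sup fun i' => q₀ i' u := ⟨_, fun _ _ => rfl⟩
  have hq_pos : ∀ i u, 0 < (∑ j, μ (i, j)) → q i u = q₀ i u := by
    intro i u hri
    rw [hq]
    refine le_antisymm (Finset.sup_le fun i' hi' => ?_) ?_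
    · rw [mem_filter] at hi'
      exact hq₀i i' i u hi'.2.1 hi'.2.2 hri
    · exact Finset.le_sup (f := fun i' => q₀ i' u) (by rw [mem_filter]; exact ⟨mem_univ _, le_rfl, hri⟩)
  have hqmono : ∀ i i' (u u' : Fin K), i ≤ i' → u ≤ u' → q i u ≤ q i' u' := by
    intro i i' u u' hii' huu'
    rw [hq, hq]
    refine Finset.sup_le fun k hk => ?_
    rw [mem_filter] at hk
    exact (hq₀u k u u' huu').trans
      (Finset.le_sup (f := fun k => q₀ k u') (by rw [mem_filter]; exact ⟨mem_univ _, hk.2.1.trans hii', hk.2.2⟩))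
  refine ⟨fun p => (p.1, q p.1 p.2), fun p p' hpp' => ⟨hpp'.1, hqmono _ _ _ _ hpp'.1 hpp'.2⟩, ?_⟩
  -- the push-forward on a positive row: cumulative fibre sums are the row distribution functions
  have hcum : ∀ i j, 0 < (∑ j, μ (i, j)) → (∑ j, μ (i, j)) * ∑ u ∈ univ.filter (fun u : Fin K => q i u ≤ j),
      (γ u.succ - γ (Fin.castSucc u)) = (∑ j', if j' ≤ j then μ (i, j') else 0) := by
    intro i j hri
    obtain ⟨v, hv⟩ := hC i j hri
    have hset : univ.filter (fun u : Fin K => q i u ≤ j) = univ.filter (fun u : Fin K => (u : ℕ) < v) := by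
      ext u
      simp only [mem_filter, mem_univ, true_and, hq_pos i u hri, hq₀, ← hv]
      rw [mul_le_mul_iff_of_pos_right hri, hγ.le_iff_le, Fin.le_def, Fin.val_succ]
      omega
    rw [hset, sum_gaps γ v (by omega), hγ0, sub_zero]
    have : (⟨(v : ℕ), by omega⟩ : Fin (K + 1)) = v := Fin.ext rfl
    rw [this, mul_comm, hv]
  have hfib : ∀ i j, 0 < (∑ j, μ (i, j)) → (∑ j, μ (i, j)) * ∑ u ∈ univ.filter (fun u : Fin K => q i u = j),
      (γ u.succ - γ (Fin.castSucc u)) = μ (i, j) := by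
    intro i j hri
    induction j using Fin.cases with
    | zero =>
      have hset : univ.filter (fun u : Fin K => q i u = 0) = univ.filter (fun u : Fin K => q i u ≤ 0) := by
        ext u; simp
      rw [hset, hcum i 0 hri, rowCDF_zero]
    | succ j' =>
      have hset : univ.filter (fun u : Fin K => q i u ≤ j'.succ) =
          univ.filter (fun u : Fin K => q i u ≤ Fin.castSucc j') ∪ univ.filter (fun u : Fin K => q i u = j'.succ) := by
        ext u
        simp only [mem_filter, mem_univ, true_and, mem_union]
        constructor
        · intro h
          rcases lt_or_eq_of_le h with h | h
          · exact Or.inl (Fin.le_castSucc_iff.2 h)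
          · exact Or.inr h
        · rintro (h | h)
          · exact h.trans (Fin.castSucc_le_succ j')
          · exact h.le
      have hdisj : Disjoint (univ.filter (fun u : Fin K => q i u ≤ Fin.castSucc j'))
          (univ.filter (fun u : Fin K => q i u = j'.succ)) := by
        rw [disjoint_filter]
        intro u _ h1 h2
        rw [h2] at h1
        exact absurd h1 (not_le.2 Fin.castSucc_lt_succ)
      have h := hcum i j'.succ hri
      rw [hset, sum_union hdisj, mul_add, hcum i _ hri, rowCDF_succ] at h
      linarith
  funext ⟨i, j⟩
  rw [pushWeight_apply, Fintype.sum_prod_type, Finset.sum_eq_single i]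
  · by_cases hri : 0 < (∑ j, μ (i, j))
    · rw [← hfib i j hri, mul_sum, ← sum_filter]
      refine sum_congr ?_ fun u _ => rfl
      ext u
      simp
    · rw [row_eq_zero_of_mass μ hμ0 hri j]
      refine sum_eq_zero fun u _ => ?_
      have hr0 : (∑ j, μ (i, j)) = 0 := le_antisymm (not_lt.1 hri) (sum_nonneg fun j _ => hμ0 _)
      split_ifs <;> simp [hr0]
  · intro i' _ hi'
    refine sum_eq_zero fun u _ => ?_
    rw [if_neg]
    intro h
    exact hi' (Prod.mk.inj h).1
  · exact fun h => (h (mem_univ _)).elim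

omit [PartialOrder ι] in
/-- **The common grid.**  For `μ ≥ 0` on `ι × Fin (b+1)` there is a strictly increasing grid `0 = γ_0 < ⋯ < γ_K = 1`,
`K ≥ 1`, containing every normalised row distribution value `S_i(j)/r_i` of every positive row. [this work] -/
theorem exists_grid (μ : ι × Fin (b + 1) → ℝ) (hμ0 : ∀ p, 0 ≤ μ p) :
    ∃ K, 0 < K ∧ ∃ γ : Fin (K + 1) → ℝ, StrictMono γ ∧ γ (Fin.last K) = 1 ∧ γ 0 = 0 ∧
      ∀ i j, 0 < (∑ j, μ (i, j)) → ∃ v, γ v * (∑ j, μ (i, j)) = (∑ j', if j' ≤ j then μ (i, j') else 0) := by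
  classical
  obtain ⟨C, hC⟩ : ∃ C : Finset ℝ, C = insert 0 (insert 1 (univ.image fun p : ι × Fin (b + 1) =>
      (∑ j', if j' ≤ p.2 then μ (p.1, j') else 0) / (∑ j, μ (p.1, j)))) := ⟨_, rfl⟩
  have h0C : (0 : ℝ) ∈ C := by rw [hC]; exact mem_insert_self _ _
  have h1C : (1 : ℝ) ∈ C := by rw [hC]; exact mem_insert_of_mem (mem_insert_self _ _)
  have hmemC : ∀ i j, (∑ j', if j' ≤ j then μ (i, j') else 0) / (∑ j, μ (i, j)) ∈ C := fun i j => by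
    rw [hC]; exact mem_insert_of_mem (mem_insert_of_mem (mem_image_of_mem _ (mem_univ (i, j))))
  have hCbounds : ∀ c ∈ C, 0 ≤ c ∧ c ≤ 1 := by
    intro c hc
    rw [hC, mem_insert, mem_insert, mem_image] at hc
    rcases hc with rfl | rfl | ⟨p, _, rfl⟩
    · exact ⟨le_rfl, zero_le_one⟩
    · exact ⟨zero_le_one, le_rfl⟩
    · by_cases hr : 0 < ∑ j, μ (p.1, j)
      · exact ⟨div_nonneg (rowCDF_nonneg μ hμ0 _ _) hr.le, (div_le_one hr).2 (rowCDF_le_rowMass μ hμ0 _ _)⟩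
      · have hr0 : (∑ j, μ (p.1, j)) = 0 := le_antisymm (not_lt.1 hr) (sum_nonneg fun j _ => hμ0 _)
        rw [hr0, div_zero]
        exact ⟨le_rfl, zero_le_one⟩
  have hcard : 2 ≤ C.card := by
    have : ({0, 1} : Finset ℝ) ⊆ C := by
      intro c hc
      simp only [mem_insert, mem_singleton] at hc
      rcases hc with rfl | rfl
      · exact h0C
      · exact h1C
    calc 2 = ({0, 1} : Finset ℝ).card := by rw [card_pair zero_ne_one]
      _ ≤ C.card := card_le_card this
  obtain ⟨K, hK⟩ : ∃ K, C.card = K + 1 := Nat.exists_eq_succ_of_ne_zero (by omega)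
  refine ⟨K, by omega, fun v => C.orderEmbOfFin hK v, (C.orderEmbOfFin hK).strictMono, ?_, ?_, fun i j hri => ?_⟩
  · show C.orderEmbOfFin hK ⟨K, by omega⟩ = 1
    have h := orderEmbOfFin_last hK (by omega)
    simp only [Nat.add_sub_cancel] at h
    rw [h]
    exact le_antisymm ((hCbounds _ (max'_mem _ _)).2) (le_max' _ _ h1C)
  · show C.orderEmbOfFin hK ⟨0, by omega⟩ = 0
    rw [orderEmbOfFin_zero hK (by omega)]
    exact le_antisymm (min'_le _ _ h0C) ((hCbounds _ (min'_mem _ _)).1)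
  · have h : (∑ j', if j' ≤ j then μ (i, j') else 0) / (∑ j, μ (i, j)) ∈ Set.range (C.orderEmbOfFin hK) := by
      rw [range_orderEmbOfFin]; exact hmemC i j
    obtain ⟨v, hv⟩ := h
    refine ⟨v, ?_⟩
    show C.orderEmbOfFin hK v * (∑ j, μ (i, j)) = (∑ j', if j' ≤ j then μ (i, j') else 0)
    rw [hv, div_mul_cancel₀ _ hri.ne']

/-- **Coupling package**: a nonnegative weight on `ι × Fin (b+1)` (rows indexed by a finite partial order) whose positive rows are stochastically increasing is the monotone image of the weight `r_i · g_u` on `ι × Fin K` for some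
probability weight `g` on a chain `Fin K`, `K ≥ 1`. [this work] -/
theorem exists_coupling (μ : ι × Fin (b + 1) → ℝ) (hμ0 : ∀ p, 0 ≤ μ p)
    (hcross : ∀ i i' j, i ≤ i' → 0 < (∑ j, μ (i, j)) → 0 < (∑ j, μ (i', j)) →
      (∑ j', if j' ≤ j then μ (i', j') else 0) * (∑ j, μ (i, j)) ≤
        (∑ j', if j' ≤ j then μ (i, j') else 0) * (∑ j, μ (i', j))) :
    ∃ K, 0 < K ∧ ∃ g : Fin K → ℝ, (∀ u, 0 ≤ g u) ∧ ∑ u, g u = 1 ∧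
      ∃ G : ι × Fin K → ι × Fin (b + 1), Monotone G ∧
        pushWeight (fun p : ι × Fin K => (∑ j, μ (p.1, j)) * g p.2) G = μ := by
  obtain ⟨K, hK, γ, hγ, hγ1, hγ0, hCγ⟩ := exists_grid μ hμ0
  obtain ⟨G, hGmono, hGpush⟩ := exists_rowQuantile_coupling μ hμ0 hcross γ hγ hγ1 hγ0 hCγ
  exact ⟨K, hK, fun u => γ u.succ - γ (Fin.castSucc u), fun u => sub_nonneg.2 (hγ.monotone (Fin.castSucc_le_succ u)),
    sum_gaps_univ γ hγ0 hγ1, G, hGmono, hGpush⟩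

end Coupling

/-! ## Two push-forward computations -/

section Push

variable {β β' κ : Type*} [Fintype β] [Fintype β'] [DecidableEq β'] [Fintype κ] [DecidableEq κ]

omit [Fintype β'] in
/-- **Push-forward of a fibred product weight along a map of the base**: `(G × id)_* (w ⊗ g) = (G_* w) ⊗ g`. [folklore] -/
theorem pushWeight_prodMap_id (w : β → ℝ) (g : κ → ℝ) (G : β → β') :
    pushWeight (fun x : β × κ => w x.1 * g x.2) (fun x => (G x.1, x.2)) =
      fun y : β' × κ => pushWeight w G y.1 * g y.2 := by
  classical
  funext ⟨y, k⟩
  rw [pushWeight_apply, pushWeight_apply, Fintype.sum_prod_type, sum_mul]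
  refine sum_congr rfl fun x _ => ?_
  rw [Finset.sum_eq_single k]
  · by_cases h : G x = y
    · simp [h]
    · rw [if_neg, if_neg h, zero_mul]
      intro h'
      exact h (Prod.mk.inj h').1
  · intro k' _ hk'
    rw [if_neg]
    intro h'
    exact hk' (Prod.mk.inj h').2
  · exact fun h => (h (mem_univ _)).elim

omit [DecidableEq κ] in
/-- The first-coordinate marginal of a weight on a product is the row-mass weight. [folklore] -/
theorem pushWeight_fst_eq (μ : β' × κ → ℝ) : pushWeight μ Prod.fst = fun y => ∑ k, μ (y, k) := by
  classical
  funext y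
  rw [pushWeight_apply, Fintype.sum_prod_type]
  refine (Finset.sum_eq_single y ?_ ?_).trans ?_
  · intro y' _ hy'
    exact sum_eq_zero fun k _ => if_neg hy'
  · exact fun h => (h (mem_univ _)).elim
  · exact sum_congr rfl fun k _ => if_pos rfl

end Push

end

end Summit.CriticalPhenomena.PercolationContinuityZ3.Theorems.SahiThreeDim
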